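import Mathlib
import HarnessLib
import Summits.AtomisticToContinuum.Crystallization.Theorems.PricedLinkCensusSoftFourRingsLocalHelpers
import Summits.AtomisticToContinuum.Crystallization.Theorems.PricedLinkCensusSoftFourRingsCapTightness
import Summits.AtomisticToContinuum.Crystallization.Theorems.PricedLinkCensusSoftFourRingsCapExtraEdge
import Summits.AtomisticToContinuum.Crystallization.Theorems.PricedLinkCensusSoftFourRingsCapFanGap
import Summits.AtomisticToContinuum.Crystallization.Theorems.PricedLinkCensusSoftFourRingsThreeTriQuad

/-!
# Soft four-rings: the isolated vertex of a slack triangle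

Support file for `SoftFourRings` (route `PricedLinkCensus`, sub-problem `Crystallization`).

Let `f = {a, b, c}` be a slack triangle (`ab` a bond, `ca`, `cb` non-bond hull edges) in the
tight regime of `tight_counts_one_percent`.  Then `c ∈ V₃`; let `w 0 – w 1 – w 2 – w 3` be its
fan.  `slack_c_vertex`: after possibly reversing the fan, **`w 0 ∼ a` and `w 3 ∼ b`**, through the
two `nb = 1` triangles `{c, w 0, a}` and `{c, w 3, b}`.  Ingredients: every hull edge lies in
exactly two facets, the other facet-neighbour along a facet, rule (B)
(`no_three_triangles_quad_one_percent`) and the corner cap (`no_facet_through_three_fan_one_percent`).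

**`Cap` variant** (seat c3 of stmt-AtomisticToContinuum-14234): identical to `PricedLinkCensusSoftFourRingsLocalC`, except that the
global Tammes-13 hypothesis `(hT : musinTarasov2012_tammes_thirteen)` is replaced by the LOCAL covering
property of the twelve directions, `hT : ∀ p, ‖p‖ = 1 → ∃ x ∈ X, dist p x < 0.957` (no empty cap of
angular radius `57.18°`), which is all the two roots (`FacetCap`, `Interior`) ever used; the hT-free
lemmas are not repeated (the original file is imported for them).
-/

namespace Summit.AtomisticToContinuum.Crystallization.Theorems.Cap

open Real RealInnerProductSpace Literature.Geometry.DiscreteGeometry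

section Setting

open scoped Classical in
/-- **One end of the fan of the isolated vertex `c` of a slack triangle.**  The bond `{c, w 0}`
lies in the bond triangle `{c, w 0, w 1}` and in a second facet, which is a triangle `{c, w 0, y}`
with `nb = 1`: `{c, y}` is a non-bond hull edge and `{w 0, y}` a bond. -/
theorem slack_c_end
    {X : Finset (EuclideanSpace ℝ (Fin 3))}
    {B : Finset (Finset (EuclideanSpace ℝ (Fin 3)))}
    (hT : ∀ p : EuclideanSpace ℝ (Fin 3), ‖p‖ = 1 → ∃ x ∈ X, dist p x < 0.957)
    (hX1 : ∀ y ∈ X, ‖y‖ = 1)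
    (hcard : X.card = 12)
    (hsepX : ∀ u ∈ X, ∀ u' ∈ X, u ≠ u' → ⟪u, u'⟫ ≤ 1 - 1 / (2 * (101 / 100 : ℝ) ^ 2))
    (hB : ∀ T ∈ B, ∃ u ∈ X, ∃ u' ∈ X, u ≠ u' ∧ 1 - (101 / 100 : ℝ) ^ 2 / 2 ≤ ⟪u, u'⟫ ∧ T = {u, u'})
    (hBcard : B.card = 24)
    (hdeg : ∀ v ∈ X, ∃ w : Fin 4 → EuclideanSpace ℝ (Fin 3), (∀ k, w k ∈ X) ∧ Function.Injective w ∧ (∀ k, w k ≠ v) ∧ (∀ k, ({v, w k} : Finset (EuclideanSpace ℝ (Fin 3))) ∈ B) ∧ ∀ y, ({v, y} : Finset (EuclideanSpace ℝ (Fin 3))) ∈ B → ∃ k, y = w k) {cf : EuclideanSpace ℝ (Fin 3)} (hcfF : cf ∈ facetNormals X)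
    (hcf3 : (tightSet X cf).card = 3)
    (hcfnb : ((edgesOfFacet X cf).filter (fun T => T ∉ B)).card = 2)
    {c : EuclideanSpace ℝ (Fin 3)} (hc : c ∈ tightSet X cf)
    (w : Fin 4 → EuclideanSpace ℝ (Fin 3)) (hwX : ∀ k, w k ∈ X) (hwinj : Function.Injective w)
    (hwv : ∀ k, w k ≠ c) (hvw : ∀ k, ({c, w k} : Finset (EuclideanSpace ℝ (Fin 3))) ∈ B)
    (hvonly : ∀ y, ({c, y} : Finset (EuclideanSpace ℝ (Fin 3))) ∈ B → ∃ k, y = w k)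
    (hB01 : ({w 0, w 1} : Finset (EuclideanSpace ℝ (Fin 3))) ∈ B)
    (hB12 : ({w 1, w 2} : Finset (EuclideanSpace ℝ (Fin 3))) ∈ B)
    (hB23 : ({w 2, w 3} : Finset (EuclideanSpace ℝ (Fin 3))) ∈ B)
    (hw0 : w 0 ∉ tightSet X cf) :
    ∃ y ∈ X, y ≠ c ∧ (∀ k, y ≠ w k) ∧ ({c, y} : Finset (EuclideanSpace ℝ (Fin 3))) ∉ B ∧
      ({c, y} : Finset (EuclideanSpace ℝ (Fin 3))) ∈ hullEdges X ∧
      ({w 0, y} : Finset (EuclideanSpace ℝ (Fin 3))) ∈ B ∧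
      ∃ h ∈ facetNormals X, tightSet X h = {c, w 0, y} ∧
        ((edgesOfFacet X h).filter (fun T => T ∉ B)).card = 1 := by
  have h0 : (0 : EuclideanSpace ℝ (Fin 3)) ∈ interior (convexHull ℝ (X : Set (EuclideanSpace ℝ (Fin 3)))) :=
    zero_mem_interior_convexHull_of_twelve_le_card hT hX1 hcard.ge
      (ca := 1 - 1 / (2 * (101 / 100 : ℝ) ^ 2)) (by norm_num) hsepX
  obtain ⟨-, hBH, -, -, -, h34, -, -⟩ := hull_counts_of_twelve hT hX1 hcard hsepX hB hBcard
  obtain ⟨-, -, hC2, hC3, hC5⟩ := tight_counts_one_percent hT hX1 hcard hsepX hB hBcard hdeg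
  have hcX : c ∈ X := (mem_tightSet.1 hc).1
  have hw01 : w 0 ≠ w 1 := fun h => by simpa using hwinj h
  have hw02 : w 0 ≠ w 2 := fun h => by simpa using hwinj h
  have hw03 : w 0 ≠ w 3 := fun h => by simpa using hwinj h
  have hw12 : w 1 ≠ w 2 := fun h => by simpa using hwinj h
  have hw13 : w 1 ≠ w 3 := fun h => by simpa using hwinj h
  have hw23 : w 2 ≠ w 3 := fun h => by simpa using hwinj h
  -- the three bond triangles at `c`
  obtain ⟨c₀, ⟨hc₀F, -, -, -⟩, hc₀T⟩ := exists_bt_at hX1 hsepX hB (hvw 0) hB01 (hvw 1)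
  obtain ⟨c₁, ⟨hc₁F, -, -, -⟩, hc₁T⟩ := exists_bt_at hX1 hsepX hB (hvw 1) hB12 (hvw 2)
  obtain ⟨c₂, ⟨hc₂F, -, -, -⟩, hc₂T⟩ := exists_bt_at hX1 hsepX hB (hvw 2) hB23 (hvw 3)
  -- the second facet through `{c, w 0}` and the other neighbour `y` of `c` in it
  have hE0 : ({c, w 0} : Finset (EuclideanSpace ℝ (Fin 3))) ∈ hullEdges X := hBH (hvw 0)
  obtain ⟨h, hhF, hhne, hhsub⟩ := exists_facet_ne_of_mem_hullEdges hX1 h0 hE0 c₀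
  have hch : c ∈ tightSet X h := hhsub (Finset.mem_insert_self _ _)
  have hw0h : w 0 ∈ tightSet X h := hhsub (by simp)
  obtain ⟨y, hyh, hyc, hyw0, hEy⟩ := exists_consecutive_neighbour hX1 h0 hhF (hwv 0).symm hE0 hhsub
  have hyX : y ∈ X := (mem_tightSet.1 hyh).1
  -- `y` is not a bond partner of `c`
  have hyB : ({c, y} : Finset (EuclideanSpace ℝ (Fin 3))) ∉ B := by
    intro hcy
    obtain ⟨k, rfl⟩ := hvonly y hcy
    have hcy_sub : ({c, w k} : Finset (EuclideanSpace ℝ (Fin 3))) ⊆ tightSet X h := by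
      intro x hx
      rw [Finset.mem_insert, Finset.mem_singleton] at hx
      rcases hx with rfl | rfl
      exacts [hch, hyh]
    fin_cases k
    · exact hyw0 rfl
    · -- three facets through `{c, w 1}`
      refine false_of_three_facetsOfEdge hX1 h0 (hBH (hvw 1)) hc₀F hc₁F hhF
        (by rw [hc₀T]; exact pair_subset_three_right _ _ _)
        (by rw [hc₁T]; exact pair_subset_three_left _ _ _) hcy_sub ?_ ?_ ?_
      · intro he
        have : w 0 ∈ tightSet X c₁ := by rw [← he, hc₀T]; simp
        rw [hc₁T] at this
        exact not_mem_three (hwv 0) hw01 hw02 this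
      · exact fun he => hhne he.symm
      · intro he
        have : w 0 ∈ tightSet X c₁ := by rw [he]; exact hw0h
        rw [hc₁T] at this
        exact not_mem_three (hwv 0) hw01 hw02 this
    · -- three facets through `{c, w 2}`
      refine false_of_three_facetsOfEdge hX1 h0 (hBH (hvw 2)) hc₁F hc₂F hhF
        (by rw [hc₁T]; exact pair_subset_three_right _ _ _)
        (by rw [hc₂T]; exact pair_subset_three_left _ _ _) hcy_sub ?_ ?_ ?_
      · intro he
        have : w 1 ∈ tightSet X c₂ := by rw [← he, hc₁T]; simp
        rw [hc₂T] at this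
        exact not_mem_three (hwv 1) hw12 hw13 this
      · intro he
        have : w 0 ∈ tightSet X c₁ := by rw [he]; exact hw0h
        rw [hc₁T] at this
        exact not_mem_three (hwv 0) hw01 hw02 this
      · intro he
        have : w 0 ∈ tightSet X c₂ := by rw [he]; exact hw0h
        rw [hc₂T] at this
        exact not_mem_three (hwv 0) hw02 hw03 this
    · -- the facet `h` would contain `c`, `w 0`, `w 3`: corner cap
      have hvwc : ∀ k, 1 - (101 / 100 : ℝ) ^ 2 / 2 ≤ ⟪c, w k⟫ :=
        fun k => (close_of_pair_mem_bonds hB (hvw k) (hwv k).symm).2.2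
      exact no_facet_through_three_fan_one_percent hT hX1 hcard.ge hsepX hcX w hwX hwinj hwv hvwc
        (close_of_pair_mem_bonds hB hB01 hw01).2.2 (close_of_pair_mem_bonds hB hB12 hw12).2.2
        (close_of_pair_mem_bonds hB hB23 hw23).2.2 (mem_facetNormals.1 hhF).1
        (mem_tightSet.1 hch).2 (mem_tightSet.1 hw0h).2 (mem_tightSet.1 hyh).2
  have hyw : ∀ k, y ≠ w k := by
    rintro k rfl; exact hyB (hvw k)
  -- the type of `h`: a triangle `{c, w 0, y}` with `nb = 1`
  have hside : ({c, y} : Finset (EuclideanSpace ℝ (Fin 3))) ∈ edgesOfFacet X h :=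
    pair_mem_edgesOfFacet hEy hch hyh
  have hnb1 : 1 ≤ ((edgesOfFacet X h).filter (fun T => T ∉ B)).card := one_le_nb_of_side hside hyB
  have hh3 : (tightSet X h).card = 3 := by
    rcases h34 h hhF with h3 | h4
    · exact h3
    · have := (hC2 h hhF).2 h4; omega
  have hhT : tightSet X h = {c, w 0, y} :=
    eq_three_of_mem_of_card hh3 hch hw0h hyh (hwv 0).symm hyc.symm (hyw 0).symm
  have htc : ((facetNormals X).filter (fun c' => c ∈ tightSet X c' ∧ (tightSet X c').card = 3 ∧
      ((edgesOfFacet X c').filter (fun T => T ∉ B)).card = 0)).card = 3 := hC3 cf hcfF hcf3 hcfnb c hc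
  have hnb : ((edgesOfFacet X h).filter (fun T => T ∉ B)).card = 1 := by
    have hle2 := (hC2 h hhF).1 hh3
    by_contra hne1
    have h2 : ((edgesOfFacet X h).filter (fun T => T ∉ B)).card = 2 := by omega
    -- `h` would be a slack triangle through `c`, hence `h = cf ∋ w 0`
    obtain ⟨c₀', -, -, -, -, huniq⟩ := hC5 c hcX htc
    have e1 := huniq cf hcfF hcf3 hcfnb hc
    have e2 := huniq h hhF hh3 h2 hch
    apply hw0
    rw [e1, ← e2]
    exact hw0h
  have hhT' : tightSet X h = {c, y, w 0} := by rw [hhT, Finset.pair_comm]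
  obtain ⟨-, hyw0B⟩ := mem_bonds_of_nb_one (B := B) hX1 h0 hhF hhT' hh3 hnb hyB
  refine ⟨y, hyX, hyc, hyw, hyB, hEy, by rw [Finset.pair_comm]; exact hyw0B, h, hhF, hhT, hnb⟩

open scoped Classical in
/-- **The far vertex of an end triangle belongs to the slack triangle.**  With the data of
`slack_c_end` at both ends (`y₀` over `w 0`, `y₃` over `w 3`, `y₀ ≠ y₃`), the non-bond hull edge
`{c, y₀}` lies in the end triangle and in a second facet; the latter has two non-bond sides at
`c`, so it is the slack triangle of `c`. -/
theorem slack_c_end_mem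
    {X : Finset (EuclideanSpace ℝ (Fin 3))}
    {B : Finset (Finset (EuclideanSpace ℝ (Fin 3)))}
    (hT : ∀ p : EuclideanSpace ℝ (Fin 3), ‖p‖ = 1 → ∃ x ∈ X, dist p x < 0.957)
    (hX1 : ∀ y ∈ X, ‖y‖ = 1)
    (hcard : X.card = 12)
    (hsepX : ∀ u ∈ X, ∀ u' ∈ X, u ≠ u' → ⟪u, u'⟫ ≤ 1 - 1 / (2 * (101 / 100 : ℝ) ^ 2))
    (hB : ∀ T ∈ B, ∃ u ∈ X, ∃ u' ∈ X, u ≠ u' ∧ 1 - (101 / 100 : ℝ) ^ 2 / 2 ≤ ⟪u, u'⟫ ∧ T = {u, u'})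
    (hBcard : B.card = 24)
    (hdeg : ∀ v ∈ X, ∃ w : Fin 4 → EuclideanSpace ℝ (Fin 3), (∀ k, w k ∈ X) ∧ Function.Injective w ∧ (∀ k, w k ≠ v) ∧ (∀ k, ({v, w k} : Finset (EuclideanSpace ℝ (Fin 3))) ∈ B) ∧ ∀ y, ({v, y} : Finset (EuclideanSpace ℝ (Fin 3))) ∈ B → ∃ k, y = w k) {cf : EuclideanSpace ℝ (Fin 3)} (hcfF : cf ∈ facetNormals X)
    (hcf3 : (tightSet X cf).card = 3)
    (hcfnb : ((edgesOfFacet X cf).filter (fun T => T ∉ B)).card = 2)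
    {c : EuclideanSpace ℝ (Fin 3)} (hc : c ∈ tightSet X cf)
    (w : Fin 4 → EuclideanSpace ℝ (Fin 3)) (hwinj : Function.Injective w)
    (hwv : ∀ k, w k ≠ c) (hvw : ∀ k, ({c, w k} : Finset (EuclideanSpace ℝ (Fin 3))) ∈ B)
    (hvonly : ∀ y, ({c, y} : Finset (EuclideanSpace ℝ (Fin 3))) ∈ B → ∃ k, y = w k)
    (hB01 : ({w 0, w 1} : Finset (EuclideanSpace ℝ (Fin 3))) ∈ B)
    (hB12 : ({w 1, w 2} : Finset (EuclideanSpace ℝ (Fin 3))) ∈ B)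
    (hB23 : ({w 2, w 3} : Finset (EuclideanSpace ℝ (Fin 3))) ∈ B)
    {y₀ y₃ h₀ h₃ : EuclideanSpace ℝ (Fin 3)} (hy₀c : y₀ ≠ c) (hy₀w : ∀ k, y₀ ≠ w k)
    (hy₀B : ({c, y₀} : Finset (EuclideanSpace ℝ (Fin 3))) ∉ B)
    (hEy₀ : ({c, y₀} : Finset (EuclideanSpace ℝ (Fin 3))) ∈ hullEdges X)
    (hh₀F : h₀ ∈ facetNormals X) (hh₀T : tightSet X h₀ = {c, w 0, y₀})
    (hy₃c : y₃ ≠ c) (hy₃w : ∀ k, y₃ ≠ w k)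
    (hh₃F : h₃ ∈ facetNormals X) (hh₃T : tightSet X h₃ = {c, w 3, y₃}) (hy₀₃ : y₀ ≠ y₃) :
    y₀ ∈ tightSet X cf := by
  have h0 : (0 : EuclideanSpace ℝ (Fin 3)) ∈ interior (convexHull ℝ (X : Set (EuclideanSpace ℝ (Fin 3)))) :=
    zero_mem_interior_convexHull_of_twelve_le_card hT hX1 hcard.ge
      (ca := 1 - 1 / (2 * (101 / 100 : ℝ) ^ 2)) (by norm_num) hsepX
  obtain ⟨-, hBH, -, -, -, h34, -, -⟩ := hull_counts_of_twelve hT hX1 hcard hsepX hB hBcard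
  obtain ⟨-, -, hC2, hC3, hC5⟩ := tight_counts_one_percent hT hX1 hcard hsepX hB hBcard hdeg
  have hcX : c ∈ X := (mem_tightSet.1 hc).1
  have hw01 : w 0 ≠ w 1 := fun h => by simpa using hwinj h
  have hw02 : w 0 ≠ w 2 := fun h => by simpa using hwinj h
  have hw03 : w 0 ≠ w 3 := fun h => by simpa using hwinj h
  have hw12 : w 1 ≠ w 2 := fun h => by simpa using hwinj h
  have hw13 : w 1 ≠ w 3 := fun h => by simpa using hwinj h
  have hw23 : w 2 ≠ w 3 := fun h => by simpa using hwinj h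
  obtain ⟨c₀, ⟨hc₀F, -, -, -⟩, hc₀T⟩ := exists_bt_at hX1 hsepX hB (hvw 0) hB01 (hvw 1)
  obtain ⟨c₁, ⟨hc₁F, -, -, -⟩, hc₁T⟩ := exists_bt_at hX1 hsepX hB (hvw 1) hB12 (hvw 2)
  obtain ⟨c₂, ⟨hc₂F, -, -, -⟩, hc₂T⟩ := exists_bt_at hX1 hsepX hB (hvw 2) hB23 (hvw 3)
  -- the second facet `h'` through the non-bond hull edge `{c, y₀}`
  obtain ⟨h', hh'F, hh'ne, hh'sub⟩ := exists_facet_ne_of_mem_hullEdges hX1 h0 hEy₀ h₀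
  have hch' : c ∈ tightSet X h' := hh'sub (Finset.mem_insert_self _ _)
  have hy₀h' : y₀ ∈ tightSet X h' := hh'sub (by simp)
  obtain ⟨y', hy'h', hy'c, hy'y₀, hEy'⟩ := exists_consecutive_neighbour hX1 h0 hh'F hy₀c.symm hEy₀ hh'sub
  -- distinctness of the known facets from `h'` (which contains `y₀`)
  have hy₀c₀ : y₀ ∉ tightSet X c₀ := by rw [hc₀T]; exact not_mem_three hy₀c (hy₀w 0) (hy₀w 1)
  have hy₀c₁ : y₀ ∉ tightSet X c₁ := by rw [hc₁T]; exact not_mem_three hy₀c (hy₀w 1) (hy₀w 2)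
  have hy₀c₂ : y₀ ∉ tightSet X c₂ := by rw [hc₂T]; exact not_mem_three hy₀c (hy₀w 2) (hy₀w 3)
  have hy₀h₃ : y₀ ∉ tightSet X h₃ := by rw [hh₃T]; exact not_mem_three hy₀c (hy₀w 3) hy₀₃
  have hne_of : ∀ d, y₀ ∉ tightSet X d → d ≠ h' := fun d hd he => hd (he ▸ hy₀h')
  by_cases hy'B : ({c, y'} : Finset (EuclideanSpace ℝ (Fin 3))) ∈ B
  · exfalso
    obtain ⟨k, rfl⟩ := hvonly y' hy'B
    have hsub' : ({c, w k} : Finset (EuclideanSpace ℝ (Fin 3))) ⊆ tightSet X h' := by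
      intro x hx
      rw [Finset.mem_insert, Finset.mem_singleton] at hx
      rcases hx with rfl | rfl
      exacts [hch', hy'h']
    fin_cases k
    · refine false_of_three_facetsOfEdge hX1 h0 (hBH (hvw 0)) hc₀F hh₀F hh'F
        (by rw [hc₀T]; exact pair_subset_three_left _ _ _)
        (by rw [hh₀T]; exact pair_subset_three_left _ _ _) hsub' ?_ (hne_of c₀ hy₀c₀) hh'ne.symm
      intro he
      have : y₀ ∈ tightSet X c₀ := by rw [he, hh₀T]; simp
      exact hy₀c₀ this
    · refine false_of_three_facetsOfEdge hX1 h0 (hBH (hvw 1)) hc₀F hc₁F hh'F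
        (by rw [hc₀T]; exact pair_subset_three_right _ _ _)
        (by rw [hc₁T]; exact pair_subset_three_left _ _ _) hsub' ?_ (hne_of c₀ hy₀c₀)
        (hne_of c₁ hy₀c₁)
      intro he
      have : w 0 ∈ tightSet X c₁ := by rw [← he, hc₀T]; simp
      rw [hc₁T] at this
      exact not_mem_three (hwv 0) hw01 hw02 this
    · refine false_of_three_facetsOfEdge hX1 h0 (hBH (hvw 2)) hc₁F hc₂F hh'F
        (by rw [hc₁T]; exact pair_subset_three_right _ _ _)
        (by rw [hc₂T]; exact pair_subset_three_left _ _ _) hsub' ?_ (hne_of c₁ hy₀c₁)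
        (hne_of c₂ hy₀c₂)
      intro he
      have : w 1 ∈ tightSet X c₂ := by rw [← he, hc₁T]; simp
      rw [hc₂T] at this
      exact not_mem_three (hwv 1) hw12 hw13 this
    · refine false_of_three_facetsOfEdge hX1 h0 (hBH (hvw 3)) hc₂F hh₃F hh'F
        (by rw [hc₂T]; intro x hx; simp at hx ⊢; tauto)
        (by rw [hh₃T]; exact pair_subset_three_left _ _ _) hsub' ?_ (hne_of c₂ hy₀c₂)
        (hne_of h₃ hy₀h₃)
      intro he
      have : y₃ ∈ tightSet X c₂ := by rw [he, hh₃T]; simp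
      rw [hc₂T] at this
      exact not_mem_three hy₃c (hy₃w 2) (hy₃w 3) this
  · -- two non-bond sides at `c`: `h'` is the slack triangle of `c`
    have hs₀ : ({c, y₀} : Finset (EuclideanSpace ℝ (Fin 3))) ∈ edgesOfFacet X h' :=
      pair_mem_edgesOfFacet hEy₀ hch' hy₀h'
    have hs' : ({c, y'} : Finset (EuclideanSpace ℝ (Fin 3))) ∈ edgesOfFacet X h' :=
      pair_mem_edgesOfFacet hEy' hch' hy'h'
    have h2 := two_le_nb_of_sides (B := B) hs₀ hs' hy₀B hy'B (fun he => by
      have : y' ∈ ({c, y₀} : Finset (EuclideanSpace ℝ (Fin 3))) := by rw [he]; simp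
      rw [Finset.mem_insert, Finset.mem_singleton] at this
      rcases this with h | h
      exacts [hy'c h, hy'y₀ h])
    have hh'3 : (tightSet X h').card = 3 := by
      rcases h34 h' hh'F with h3 | h4
      · exact h3
      · have := (hC2 h' hh'F).2 h4; omega
    have hnb' : ((edgesOfFacet X h').filter (fun T => T ∉ B)).card = 2 := by
      have := (hC2 h' hh'F).1 hh'3; omega
    have htc : ((facetNormals X).filter (fun c' => c ∈ tightSet X c' ∧ (tightSet X c').card = 3 ∧
        ((edgesOfFacet X c').filter (fun T => T ∉ B)).card = 0)).card = 3 :=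
      hC3 cf hcfF hcf3 hcfnb c hc
    obtain ⟨c₀', -, -, -, -, huniq⟩ := hC5 c hcX htc
    rw [huniq cf hcfF hcf3 hcfnb hc, ← huniq h' hh'F hh'3 hnb' hch']
    exact hy₀h'

open scoped Classical in
/-- **The isolated vertex of a slack triangle.**  Let `f = {a, b, c}` be a slack triangle with
bond `ab` and non-bond sides `ca`, `cb`.  Then the four bonds of `c` can be enumerated as a fan
`w 0 – w 1 – w 2 – w 3` (bonds exactly the path) with **`w 0 ∼ a` and `w 3 ∼ b`**, through
the `nb = 1` triangles `{c, w 0, a}` and `{c, w 3, b}`. -/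
theorem slack_c_vertex
    {X : Finset (EuclideanSpace ℝ (Fin 3))}
    {B : Finset (Finset (EuclideanSpace ℝ (Fin 3)))}
    (hT : ∀ p : EuclideanSpace ℝ (Fin 3), ‖p‖ = 1 → ∃ x ∈ X, dist p x < 0.957)
    (hX1 : ∀ y ∈ X, ‖y‖ = 1)
    (hcard : X.card = 12)
    (hsepX : ∀ u ∈ X, ∀ u' ∈ X, u ≠ u' → ⟪u, u'⟫ ≤ 1 - 1 / (2 * (101 / 100 : ℝ) ^ 2))
    (hB : ∀ T ∈ B, ∃ u ∈ X, ∃ u' ∈ X, u ≠ u' ∧ 1 - (101 / 100 : ℝ) ^ 2 / 2 ≤ ⟪u, u'⟫ ∧ T = {u, u'})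
    (hBcard : B.card = 24)
    (hdeg : ∀ v ∈ X, ∃ w : Fin 4 → EuclideanSpace ℝ (Fin 3), (∀ k, w k ∈ X) ∧ Function.Injective w ∧ (∀ k, w k ≠ v) ∧ (∀ k, ({v, w k} : Finset (EuclideanSpace ℝ (Fin 3))) ∈ B) ∧ ∀ y, ({v, y} : Finset (EuclideanSpace ℝ (Fin 3))) ∈ B → ∃ k, y = w k) {cf : EuclideanSpace ℝ (Fin 3)} (hcfF : cf ∈ facetNormals X)
    (hcf3 : (tightSet X cf).card = 3)
    (hcfnb : ((edgesOfFacet X cf).filter (fun T => T ∉ B)).card = 2)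
    {a b c : EuclideanSpace ℝ (Fin 3)} (hTabc : tightSet X cf = {a, b, c})
    (hca : ({c, a} : Finset (EuclideanSpace ℝ (Fin 3))) ∉ B)
    (hcb : ({c, b} : Finset (EuclideanSpace ℝ (Fin 3))) ∉ B) :
    ∃ w : Fin 4 → EuclideanSpace ℝ (Fin 3), (∀ k, w k ∈ X) ∧ Function.Injective w ∧
      (∀ k, w k ≠ c) ∧ (∀ k, ({c, w k} : Finset (EuclideanSpace ℝ (Fin 3))) ∈ B) ∧
      (∀ y, ({c, y} : Finset (EuclideanSpace ℝ (Fin 3))) ∈ B → ∃ k, y = w k) ∧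
      ({w 0, w 1} : Finset (EuclideanSpace ℝ (Fin 3))) ∈ B ∧
      ({w 1, w 2} : Finset (EuclideanSpace ℝ (Fin 3))) ∈ B ∧
      ({w 2, w 3} : Finset (EuclideanSpace ℝ (Fin 3))) ∈ B ∧
      ({w 0, w 2} : Finset (EuclideanSpace ℝ (Fin 3))) ∉ B ∧
      ({w 1, w 3} : Finset (EuclideanSpace ℝ (Fin 3))) ∉ B ∧
      ({w 0, w 3} : Finset (EuclideanSpace ℝ (Fin 3))) ∉ B ∧
      ({w 0, a} : Finset (EuclideanSpace ℝ (Fin 3))) ∈ B ∧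
      ({w 3, b} : Finset (EuclideanSpace ℝ (Fin 3))) ∈ B ∧
      (∃ g ∈ facetNormals X, tightSet X g = {c, w 0, a} ∧
        ((edgesOfFacet X g).filter (fun T => T ∉ B)).card = 1) ∧
      (∃ g' ∈ facetNormals X, tightSet X g' = {c, w 3, b} ∧
        ((edgesOfFacet X g').filter (fun T => T ∉ B)).card = 1) := by
  have h0 : (0 : EuclideanSpace ℝ (Fin 3)) ∈ interior (convexHull ℝ (X : Set (EuclideanSpace ℝ (Fin 3)))) :=
    zero_mem_interior_convexHull_of_twelve_le_card hT hX1 hcard.ge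
      (ca := 1 - 1 / (2 * (101 / 100 : ℝ) ^ 2)) (by norm_num) hsepX
  obtain ⟨-, -, -, hC3, -⟩ := tight_counts_one_percent hT hX1 hcard hsepX hB hBcard hdeg
  obtain ⟨hab', hac, hbc⟩ := card_three_distinct (hTabc ▸ hcf3)
  have hc : c ∈ tightSet X cf := by rw [hTabc]; simp
  have hcX : c ∈ X := (mem_tightSet.1 hc).1
  have htc := hC3 cf hcfF hcf3 hcfnb c hc
  -- the fan of `c`
  obtain ⟨w₀, hwX₀, hwinj₀, hwv₀, hvw₀, hvonly₀⟩ := hdeg c hcX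
  obtain ⟨w, hwX, hwinj, hwv, hvw, hvonly, hB01, hB12, hB23, hB02, hB13, hB03⟩ :=
    exists_path_family_of_three hX1 h0 hsepX hB hcX w₀ hwX₀ hwinj₀ hwv₀ hvw₀ hvonly₀ htc
  have hwcf : ∀ k, w k ∉ tightSet X cf := by
    intro k hk
    rw [hTabc, Finset.mem_insert, Finset.mem_insert, Finset.mem_singleton] at hk
    rcases hk with h | h | h
    · exact hca (by rw [← h, Finset.pair_comm]; simpa [Finset.pair_comm] using hvw k)
    · exact hcb (by rw [← h]; exact hvw k)
    · exact hwv k h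
  -- the reversed fan
  obtain ⟨hwX', hwinj', hwv', hvw', hvonly', hB01', hB12', hB23', hr0, hr3, hr1, hr2⟩ :=
    path_family_rev w hwX hwinj hwv hvw hvonly hB01 hB12 hB23
  -- both ends
  obtain ⟨y₀, hy₀X, hy₀c, hy₀w, hy₀B, hEy₀, hwy₀, h₀, hh₀F, hh₀T, hh₀nb⟩ :=
    slack_c_end hT hX1 hcard hsepX hB hBcard hdeg hcfF hcf3 hcfnb hc w hwX hwinj hwv hvw hvonly
      hB01 hB12 hB23 (hwcf 0)
  obtain ⟨y₃, hy₃X, hy₃c, hy₃w', hy₃B, hEy₃, hwy₃, h₃, hh₃F, hh₃T, hh₃nb⟩ :=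
    slack_c_end hT hX1 hcard hsepX hB hBcard hdeg hcfF hcf3 hcfnb hc (w ∘ Fin.rev) hwX' hwinj' hwv'
      hvw' hvonly' hB01' hB12' hB23' (by rw [hr0]; exact hwcf 3)
  rw [hr0] at hwy₃ hh₃T
  have hy₃w : ∀ k, y₃ ≠ w k := fun k h => hy₃w' (Fin.rev k) (by simpa using h)
  have hy₀w' : ∀ k, y₀ ≠ (w ∘ Fin.rev) k := fun k h => hy₀w (Fin.rev k) (by simpa using h)
  -- `y₀ ≠ y₃` by rule (B)
  have hy₀₃ : y₀ ≠ y₃ := by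
    rintro rfl
    have hvwc : ∀ k, 1 - (101 / 100 : ℝ) ^ 2 / 2 ≤ ⟪c, w k⟫ ∧
        ⟪c, w k⟫ ≤ 1 - 1 / (2 * (101 / 100 : ℝ) ^ 2) := fun k =>
      ⟨(close_of_pair_mem_bonds hB (hvw k) (hwv k).symm).2.2, hsepX c hcX (w k) (hwX k) (hwv k).symm⟩
    have hsep : ∀ i j, i ≠ j → ⟪w i, w j⟫ ≤ 1 - 1 / (2 * (101 / 100 : ℝ) ^ 2) :=
      fun i j hij => hsepX (w i) (hwX i) (w j) (hwX j) (fun h => hij (hwinj h))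
    exact no_three_triangles_quad_one_percent (hX1 c hcX) w (fun k => hX1 _ (hwX k)) y₀
      (hX1 y₀ hy₀X) hvwc hsep (close_of_mem_bonds hX1 hB _ _ hB01)
      (close_of_mem_bonds hX1 hB _ _ hB12) (close_of_mem_bonds hX1 hB _ _ hB23)
      (hsepX c hcX y₀ hy₀X hy₀c.symm) (close_of_mem_bonds hX1 hB _ _ hwy₀)
      (close_of_mem_bonds hX1 hB _ _ hwy₃)
  -- both far vertices lie in the slack triangle, hence are `a` and `b`
  have hy₀cf : y₀ ∈ tightSet X cf :=
    slack_c_end_mem hT hX1 hcard hsepX hB hBcard hdeg hcfF hcf3 hcfnb hc w hwinj hwv hvw hvonly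
      hB01 hB12 hB23 hy₀c hy₀w hy₀B hEy₀ hh₀F hh₀T hy₃c hy₃w hh₃F hh₃T hy₀₃
  have hy₃cf : y₃ ∈ tightSet X cf := by
    refine slack_c_end_mem hT hX1 hcard hsepX hB hBcard hdeg hcfF hcf3 hcfnb hc (w ∘ Fin.rev) hwinj'
      hwv' hvw' hvonly' hB01' hB12' hB23' hy₃c hy₃w' hy₃B hEy₃ hh₃F (by rw [hr0]; exact hh₃T) hy₀c
      hy₀w' hh₀F (by rw [hr3]; exact hh₀T) (Ne.symm hy₀₃)
  rw [hTabc, Finset.mem_insert, Finset.mem_insert, Finset.mem_singleton] at hy₀cf hy₃cf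
  have hy₀ab : y₀ = a ∨ y₀ = b := by
    rcases hy₀cf with h | h | h
    exacts [Or.inl h, Or.inr h, absurd h hy₀c]
  have hy₃ab : y₃ = a ∨ y₃ = b := by
    rcases hy₃cf with h | h | h
    exacts [Or.inl h, Or.inr h, absurd h hy₃c]
  rcases hy₀ab with rfl | rfl
  · -- `y₀ = a`, so `y₃ = b`: keep the orientation
    have hy₃b : y₃ = b := by
      rcases hy₃ab with h | h
      exacts [absurd h.symm hy₀₃, h]
    subst hy₃b
    exact ⟨w, hwX, hwinj, hwv, hvw, hvonly, hB01, hB12, hB23, hB02, hB13, hB03, hwy₀, hwy₃,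
      ⟨h₀, hh₀F, hh₀T, hh₀nb⟩, ⟨h₃, hh₃F, hh₃T, hh₃nb⟩⟩
  · -- `y₀ = b`, so `y₃ = a`: reverse the fan
    have hy₃a : y₃ = a := by
      rcases hy₃ab with h | h
      exacts [h, absurd h.symm hy₀₃]
    subst hy₃a
    refine ⟨w ∘ Fin.rev, hwX', hwinj', hwv', hvw', hvonly', hB01', hB12', hB23', ?_, ?_, ?_, ?_, ?_,
      ⟨h₃, hh₃F, by rw [hr0]; exact hh₃T, hh₃nb⟩, ⟨h₀, hh₀F, by rw [hr3]; exact hh₀T, hh₀nb⟩⟩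
    · rw [hr0, hr2, Finset.pair_comm]; exact hB13
    · rw [hr1, hr3, Finset.pair_comm]; exact hB02
    · rw [hr0, hr3, Finset.pair_comm]; exact hB03
    · rw [hr0]; exact hwy₃
    · rw [hr3]; exact hwy₀

end Setting

end Summit.AtomisticToContinuum.Crystallization.Theorems.Cap
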